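import Mathlib.Analysis.Distribution.SchwartzSpace.Basic
import Mathlib.Analysis.Calculus.UniformLimitsDeriv
import Mathlib.Analysis.LocallyConvex.Barrelled
import Mathlib.Topology.Baire.CompleteMetrizable
import Mathlib.Topology.MetricSpace.Equicontinuity
import HarnessLib

/-!
# The Schwartz space is a Fréchet space; separately continuous multilinear forms are continuous

Trunk `AnalysisL` (topic `Analysis/FunctionSpaces`), support file for the discharge of
`Literature.MathematicalPhysics.QuantumLattice.IsWightmanQFT.existsUnique_wightmanFamily` (`WightmanFunctions`): the passage from the
*separately* continuous multilinear Wightman functionals of Streater–Wightman (1964), §3-3, to the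
*jointly* continuous forms consumed by the tree's Schwartz kernel theorem
`Literature.MathematicalPhysics.QuantumLattice.existsUnique_schwartzKernel` (`MathematicalPhysics/QuantumLattice/SchwartzKernelTheorem`).

* `Literature.Analysis.FunctionSpaces.cauchySeq_schwartzMap_iff` — Cauchy sequences of `𝓢(E, F)` are the sequences that are
  Cauchy for every Schwartz seminorm `p_{k,n}`;
* `Literature.Analysis.FunctionSpaces.completeSpace_schwartzMap` — **`𝓢(E, F)` is complete** (`F` complete): with Mathlib's
  `SchwartzMap.instFirstCountableTopology` and `instLocallyConvexSpace` this says that `𝓢(E, F)` is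
  a Fréchet space (Rudin, *Functional Analysis*, Thm 7.4 (a));
* `Literature.Analysis.FunctionSpaces.baireSpace_schwartzMap`, `Literature.Analysis.FunctionSpaces.barrelledSpace_schwartzMap` — hence Baire
  (`BaireSpace.of_completelyPseudoMetrizable`) and barrelled (`BaireSpace.instBarrelledSpace`), so
  that Mathlib's Banach–Steinhaus theorem `WithSeminorms.banach_steinhaus` applies;
* `Literature.Analysis.FunctionSpaces.MultilinearMap.continuous_of_continuous_update_schwartz` — **a separately continuous
  multilinear map on `𝓢(E, V)ⁿ` with values in a normed space is (jointly) continuous** (Rudin,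
  *Functional Analysis*, Thm 2.17, the bilinear case `X × Y → Z` with `X` an F-space and `Y`
  metrizable; the `n`-linear case by induction on `n`, freezing the last variable).

## Proofs

Completeness: a sequence `(u_a)` Cauchy in every `p_{k,n}` has, for each `n` and `x`, Cauchy
derivatives `Dⁿu_a(x)` in the complete space `E [×n]→L[ℝ] F`; their limits `Gₙ(x)` are uniform
limits with the weights `‖x‖^k`, so `G₀` is smooth with `DⁿG₀ = Gₙ` (Mathlib
`hasFDerivAt_of_tendstoUniformly`, `iteratedFDeriv_succ_eq_comp_left`,
`contDiff_of_differentiable_iteratedFDeriv`), has finite Schwartz seminorms (Cauchy sequences are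
bounded) and `p_{k,n}(u_a - G₀) → 0` (Rudin, proof of Thm 7.4 (a) / §1.46). Sequential completeness
suffices because the uniformity of the topological additive group `𝓢(E, F)` is countably generated
(`IsUniformAddGroup.uniformity_countably_generated`, `UniformSpace.complete_of_cauchySeq_tendsto`).

Joint continuity: by induction on `n`; for an `(n+1)`-linear `M` write
`M(f) = L_{init f}(f_last)` with `L_h = M(h, ·)` continuous linear; if `f⁽ʲ⁾ → f` then
`L_{h_j}(g) → L_h(g)` for every `g` (induction hypothesis applied to `h ↦ M(h, g)`), so the `L_{h_j}`
are pointwise bounded, hence equicontinuous by Banach–Steinhaus on the barrelled space `𝓢(E, V)`,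
whence `L_{h_j}(g_j - g) → 0`; sequential continuity is continuity on the first countable space
`𝓢(E, V)ⁿ⁺¹` (Rudin, proof of Thm 2.17).

## References

* W. Rudin, *Functional Analysis*, 2nd ed., McGraw–Hill (1991), Thm 2.17 (separately continuous
  bilinear maps on an F-space × metrizable space are continuous; PDF p. 43), Thm 7.4 (a) (`𝒮ₙ` is a
  Fréchet space; PDF p. 137). [Rudin1991]
* R. F. Streater, A. S. Wightman, *PCT, Spin and Statistics, and All That* (1964), §2-1 (test
  function spaces, Thm 2-1) and §3-3 — the consumer.

## Mathlib

Used: `schwartz_withSeminorms` (`WithSeminorms.hasBasis_zero_ball`, `tendsto_nhds_atTop`),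
`uniformity_eq_comap_nhds_zero`, `Filter.HasBasis.cauchySeq_iff`,
`UniformSpace.complete_of_cauchySeq_tendsto`, `CauchySeq.tendsto_limUnder`,
`hasFDerivAt_of_tendstoUniformly`, `iteratedFDeriv_succ_eq_comp_left`, `iteratedFDeriv_zero_eq_comp`,
`contDiff_of_differentiable_iteratedFDeriv`, `iteratedFDeriv_sub_apply`,
`BaireSpace.instBarrelledSpace`, `WithSeminorms.banach_steinhaus`, `norm_withSeminorms`,
`Metric.equicontinuousAt_iff_right`, `MultilinearMap.curryRight`, `Fin.snoc_update`,
`Fin.update_snoc_last`, `Fin.snoc_init_self`, `continuous_iff_seqContinuous`. Searched and absent at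
the pin: `CompleteSpace`/`BaireSpace`/`BarrelledSpace` instances for `SchwartzMap`, and any
separate-to-joint continuity statement for multilinear maps on non-normed spaces
(`rg "CompleteSpace|Baire|Barrelled" Mathlib/Analysis/Distribution`: no hits). All results are
stated as theorems (to be used with `haveI`), not instances.
-/

noncomputable section

open Filter Topology Uniformity
open scoped SchwartzMap ContDiff

namespace Literature.Analysis.FunctionSpaces

variable {E F : Type*} [NormedAddCommGroup E] [NormedSpace ℝ E] [NormedAddCommGroup F]
  [NormedSpace ℝ F]

/-! ### Cauchy sequences and completeness -/

/-- **Cauchy sequences in the Schwartz space**: a sequence in `𝓢(E, F)` is Cauchy (for the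
uniformity of the topological additive group `𝓢(E, F)`) iff it is Cauchy for every Schwartz
seminorm `p_{k,n}` (the uniformity is `comap (y - x) (𝓝 0)` and the seminorm balls form a basis
of `𝓝 0`, `schwartz_withSeminorms`). [folklore] -/
theorem cauchySeq_schwartzMap_iff (u : ℕ → 𝓢(E, F)) :
    CauchySeq u ↔ ∀ (k n : ℕ) (ε : ℝ), 0 < ε → ∃ N, ∀ a, N ≤ a → ∀ b, N ≤ b →
      SchwartzMap.seminorm ℝ k n (u b - u a) < ε := by
  have hb := ((schwartz_withSeminorms ℝ E F).hasBasis_zero_ball).comap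
    (fun x : 𝓢(E, F) × 𝓢(E, F) => x.2 - x.1)
  rw [← uniformity_eq_comap_nhds_zero] at hb
  rw [hb.cauchySeq_iff]
  constructor
  · intro h k n ε hε
    obtain ⟨N, hN⟩ := h ({(k, n)}, ε) hε
    refine ⟨N, fun a ha b hb' => ?_⟩
    have := hN a ha b hb'
    simpa [Seminorm.mem_ball, Finset.sup_singleton, schwartzSeminormFamily] using this
  · rintro h ⟨s, ε⟩ hε
    choose N hN using fun m : ℕ × ℕ => h m.1 m.2 ε hε
    refine ⟨s.sup N, fun a ha b hb' => ?_⟩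
    simp only [Set.mem_preimage, Seminorm.mem_ball, sub_zero]
    refine Seminorm.finset_sup_apply_lt hε fun m hm => ?_
    exact hN m a ((Finset.le_sup hm).trans ha) b ((Finset.le_sup hm).trans hb')

/-- **The Schwartz space is complete** (Rudin, *Functional Analysis*, Thm 7.4 (a): `𝒮ₙ` is a
Fréchet space; here for `𝓢(E, F)` with `F` complete). Together with Mathlib's
`SchwartzMap.instFirstCountableTopology` and `instLocallyConvexSpace`: `𝓢(E, F)` is a Fréchet
space. Stated as a theorem; use `haveI`. [cite: Rudin1991, Thm 7.4(a)] -/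
theorem completeSpace_schwartzMap [CompleteSpace F] : CompleteSpace 𝓢(E, F) := by
  have : (𝓤 𝓢(E, F)).IsCountablyGenerated := IsUniformAddGroup.uniformity_countably_generated
  refine UniformSpace.complete_of_cauchySeq_tendsto fun u hu => ?_
  have hC := (cauchySeq_schwartzMap_iff u).1 hu
  have hcoe : ∀ a b : ℕ, (⇑(u a - u b) : E → F) = ⇑(u a) - ⇑(u b) := fun a b => rfl
  have hsub : ∀ (n : ℕ) (a b : ℕ) (x : E), iteratedFDeriv ℝ n (⇑(u a - u b)) x =
      iteratedFDeriv ℝ n (u a) x - iteratedFDeriv ℝ n (u b) x := fun n a b x => by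
    rw [hcoe]
    exact iteratedFDeriv_sub_apply ((u a).smooth n).contDiffAt ((u b).smooth n).contDiffAt
  -- (1) the derivatives are pointwise Cauchy, hence converge
  have hpt : ∀ (n : ℕ) (x : E), CauchySeq fun a => iteratedFDeriv ℝ n (u a) x := by
    intro n x
    rw [Metric.cauchySeq_iff]
    intro ε hε
    obtain ⟨N, hN⟩ := hC 0 n ε hε
    refine ⟨N, fun a ha b hb' => ?_⟩
    rw [dist_eq_norm, ← hsub]
    have h1 := SchwartzMap.norm_iteratedFDeriv_le_seminorm ℝ (u a - u b) n x
    exact h1.trans_lt (hN b hb' a ha)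
  set G : (n : ℕ) → E → (E [×n]→L[ℝ] F) := fun n x =>
    limUnder atTop fun a => iteratedFDeriv ℝ n (u a) x with hG
  have hGt : ∀ (n : ℕ) (x : E), Tendsto (fun a => iteratedFDeriv ℝ n (u a) x) atTop (𝓝 (G n x)) :=
    fun n x => (hpt n x).tendsto_limUnder
  -- (2) uniform convergence with weights
  have hunif : ∀ (k n : ℕ) (ε : ℝ), 0 < ε → ∃ N, ∀ a, N ≤ a → ∀ x,
      ‖x‖ ^ k * ‖iteratedFDeriv ℝ n (u a) x - G n x‖ ≤ ε := by
    intro k n ε hε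
    obtain ⟨N, hN⟩ := hC k n ε hε
    refine ⟨N, fun a ha x => ?_⟩
    have ht : Tendsto (fun b => ‖x‖ ^ k * ‖iteratedFDeriv ℝ n (u a) x - iteratedFDeriv ℝ n (u b) x‖)
        atTop (𝓝 (‖x‖ ^ k * ‖iteratedFDeriv ℝ n (u a) x - G n x‖)) :=
      ((tendsto_const_nhds.sub (hGt n x)).norm).const_mul _
    refine le_of_tendsto ht (eventually_atTop.2 ⟨N, fun b hb' => ?_⟩)
    rw [← hsub]
    exact (SchwartzMap.le_seminorm ℝ k n (u a - u b) x).trans (hN b hb' a ha).le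
  -- (3) the limits are the successive derivatives of one another
  have hderiv : ∀ (n : ℕ) (x : E), HasFDerivAt (G n)
      (continuousMultilinearCurryLeftEquiv ℝ (fun _ : Fin (n + 1) => E) F (G (n + 1) x)) x := by
    intro n
    set e := continuousMultilinearCurryLeftEquiv ℝ (fun _ : Fin (n + 1) => E) F with he
    refine hasFDerivAt_of_tendstoUniformly (l := atTop) (f := fun a => iteratedFDeriv ℝ n (u a))
      (f' := fun a x => e (iteratedFDeriv ℝ (n + 1) (u a) x)) ?_ ?_ (hGt n)
    · rw [Metric.tendstoUniformly_iff]
      intro ε hε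
      obtain ⟨N, hN⟩ := hunif 0 (n + 1) (ε / 2) (half_pos hε)
      refine eventually_atTop.2 ⟨N, fun a ha x => ?_⟩
      change dist (e (G (n + 1) x)) (e (iteratedFDeriv ℝ (n + 1) (u a) x)) < ε
      rw [e.isometry.dist_eq, dist_eq_norm, norm_sub_rev]
      have := hN a ha x
      rw [pow_zero, one_mul] at this
      linarith
    · intro a x
      have hd : HasFDerivAt (iteratedFDeriv ℝ n (u a)) (fderiv ℝ (iteratedFDeriv ℝ n (u a)) x) x :=
        (((u a).smooth ⊤).differentiable_iteratedFDeriv (mod_cast ENat.coe_lt_top n) x).hasFDerivAt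
      have h' : e (iteratedFDeriv ℝ (n + 1) (u a) x) = fderiv ℝ (iteratedFDeriv ℝ n (u a)) x := by
        rw [he, iteratedFDeriv_succ_eq_comp_left, Function.comp_apply,
          LinearIsometryEquiv.apply_symm_apply]
      change HasFDerivAt (iteratedFDeriv ℝ n (u a)) (e (iteratedFDeriv ℝ (n + 1) (u a) x)) x
      rw [h']
      exact hd
  -- (4) the limit function and its Schwartz structure
  set g₀ : E → F := fun x => continuousMultilinearCurryFin0 ℝ E F (G 0 x) with hg₀
  have hiter : ∀ n : ℕ, iteratedFDeriv ℝ n g₀ = G n := by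
    intro n
    induction n with
    | zero =>
      funext x
      rw [iteratedFDeriv_zero_eq_comp, Function.comp_apply, hg₀]
      simp only [LinearIsometryEquiv.symm_apply_apply]
    | succ n ih =>
      funext x
      rw [iteratedFDeriv_succ_eq_comp_left, Function.comp_apply, ih, (hderiv n x).fderiv,
        LinearIsometryEquiv.symm_apply_apply]
  have hsmooth : ContDiff ℝ ∞ g₀ := by
    refine contDiff_of_differentiable_iteratedFDeriv fun m _ => ?_
    rw [hiter m]
    exact fun x => (hderiv m x).differentiableAt
  have hdecay : ∀ k n : ℕ, ∃ C : ℝ, ∀ x, ‖x‖ ^ k * ‖iteratedFDeriv ℝ n g₀ x‖ ≤ C := by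
    intro k n
    obtain ⟨N, hN⟩ := hunif k n 1 one_pos
    refine ⟨SchwartzMap.seminorm ℝ k n (u N) + 1, fun x => ?_⟩
    rw [hiter n]
    calc ‖x‖ ^ k * ‖G n x‖
        ≤ ‖x‖ ^ k * (‖iteratedFDeriv ℝ n (u N) x‖ + ‖iteratedFDeriv ℝ n (u N) x - G n x‖) := by
          gcongr
          exact norm_le_norm_add_norm_sub _ _
      _ = ‖x‖ ^ k * ‖iteratedFDeriv ℝ n (u N) x‖ + ‖x‖ ^ k * ‖iteratedFDeriv ℝ n (u N) x - G n x‖ :=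
          mul_add _ _ _
      _ ≤ SchwartzMap.seminorm ℝ k n (u N) + 1 :=
          add_le_add (SchwartzMap.le_seminorm ℝ k n (u N) x) (hN N le_rfl x)
  let g : 𝓢(E, F) := ⟨g₀, hsmooth, hdecay⟩
  -- (5) convergence in the Schwartz topology
  refine ⟨g, ?_⟩
  rw [(schwartz_withSeminorms ℝ E F).tendsto_nhds_atTop]
  rintro ⟨k, n⟩ ε hε
  obtain ⟨N, hN⟩ := hunif k n (ε / 2) (half_pos hε)
  refine ⟨N, fun a ha => ?_⟩
  change SchwartzMap.seminorm ℝ k n (u a - g) < ε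
  refine lt_of_le_of_lt (SchwartzMap.seminorm_le_bound ℝ k n _ (half_pos hε).le fun x => ?_)
    (half_lt_self hε)
  have h1 : iteratedFDeriv ℝ n (⇑(u a - g)) x = iteratedFDeriv ℝ n (u a) x - G n x := by
    rw [← congrFun (hiter n) x]
    exact iteratedFDeriv_sub_apply ((u a).smooth n).contDiffAt (g.smooth n).contDiffAt
  rw [h1]
  exact hN a ha x

/-! ### Baire and barrelled -/

section Barrelled

variable {𝕜 : Type*} [NontriviallyNormedField 𝕜]
variable {V : Type*} [NormedAddCommGroup V] [NormedSpace ℝ V] [CompleteSpace V]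

/-- The Schwartz space is a Baire space (complete, `completeSpace_schwartzMap`, with countably
generated uniformity, `IsUniformAddGroup.uniformity_countably_generated`; Mathlib's
`BaireSpace.of_completelyPseudoMetrizable`). Rudin, *Functional Analysis*, Thm 7.4 (a) with §2.2.
[cite: Rudin1991, Thm 7.4(a)] -/
theorem baireSpace_schwartzMap : BaireSpace 𝓢(E, V) := by
  have : CompleteSpace 𝓢(E, V) := completeSpace_schwartzMap
  have : (𝓤 𝓢(E, V)).IsCountablyGenerated := IsUniformAddGroup.uniformity_countably_generated
  infer_instance

/-- The Schwartz space is barrelled over any normed field of scalars acting on it (Baire spaces are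
barrelled, Mathlib `BaireSpace.instBarrelledSpace`), so the Banach–Steinhaus theorem
`WithSeminorms.banach_steinhaus` applies to families of continuous linear maps on `𝓢(E, V)`
(Rudin, *Functional Analysis*, Thm 2.6 with Thm 7.4 (a)). [cite: Rudin1991, Thm 7.4(a)] -/
theorem barrelledSpace_schwartzMap [NormedSpace 𝕜 V] [SMulCommClass ℝ 𝕜 V] :
    BarrelledSpace 𝕜 𝓢(E, V) := by
  have := baireSpace_schwartzMap (E := E) (V := V)
  infer_instance

end Barrelled

/-! ### Separately continuous multilinear maps on `𝓢(E, V)ⁿ` are continuous -/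

section Multilinear

variable {𝕜 : Type*} [RCLike 𝕜]
variable {V : Type*} [NormedAddCommGroup V] [NormedSpace ℝ V] [NormedSpace 𝕜 V]
  [SMulCommClass ℝ 𝕜 V] [CompleteSpace V]
variable {G : Type*} [NormedAddCommGroup G] [NormedSpace 𝕜 G]

/-- **Separately continuous multilinear maps on Schwartz space are jointly continuous.** If an
`n`-linear map `M : 𝓢(E, V)ⁿ → G` into a normed space is continuous in each variable with the
others held fixed, then it is continuous on `𝓢(E, V)ⁿ`. Rudin, *Functional Analysis*, Thm 2.17
proves the bilinear case `B : X × Y → Z` for an F-space `X` and metrizable `Y` by the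
Banach–Steinhaus theorem; the `n`-linear case follows by induction on `n`, writing
`M(f) = M(init f, f_last)`: the maps `L_h = M(h, ·)` along a convergent sequence `h_j → h` converge
pointwise (induction hypothesis), hence are equicontinuous (Banach–Steinhaus on the barrelled space
`𝓢(E, V)`, `barrelledSpace_schwartzMap`), and `𝓢(E, V)ⁿ` is first countable, so sequential
continuity suffices. This is the step from Streater–Wightman's separately continuous functionals
(§2-1, Thm 2-1) to the jointly continuous forms of `Literature.MathematicalPhysics.QuantumLattice.existsUnique_schwartzKernel`.
[cite: Rudin1991, Thm 2.17] -/
theorem MultilinearMap.continuous_of_continuous_update_schwartz :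
    ∀ {n : ℕ} (M : MultilinearMap 𝕜 (fun _ : Fin n => 𝓢(E, V)) G),
      (∀ (f : Fin n → 𝓢(E, V)) (i : Fin n), Continuous fun g => M (Function.update f i g)) →
      Continuous M := by
  intro n
  induction n with
  | zero =>
    intro M _
    exact continuous_of_const fun a b => congrArg M (Subsingleton.elim a b)
  | succ n ih =>
    intro M hM
    have hbar : BarrelledSpace 𝕜 𝓢(E, V) := barrelledSpace_schwartzMap
    -- continuity in the last variable and the continuous linear maps `L h = M (h, ·)`
    have hlast : ∀ h : Fin n → 𝓢(E, V), Continuous fun g : 𝓢(E, V) => M (Fin.snoc h g) := by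
      intro h
      have := hM (Fin.snoc h 0) (Fin.last n)
      simpa only [Fin.update_snoc_last] using this
    let L : (Fin n → 𝓢(E, V)) → 𝓢(E, V) →L[𝕜] G := fun h => ⟨M.curryRight h, hlast h⟩
    have hL : ∀ h g, L h g = M (Fin.snoc h g) := fun h g => rfl
    -- continuity in the first `n` variables (induction hypothesis)
    have hinit : ∀ g : 𝓢(E, V), Continuous fun h : Fin n → 𝓢(E, V) => M (Fin.snoc h g) := by
      intro g
      let Mg : MultilinearMap 𝕜 (fun _ : Fin n => 𝓢(E, V)) G :=
        (LinearMap.applyₗ g).compMultilinearMap M.curryRight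
      have hMg : ∀ h, Mg h = M (Fin.snoc h g) := fun h => rfl
      have hc : Continuous Mg := by
        refine ih Mg fun h i => ?_
        simp only [hMg, Fin.snoc_update]
        exact hM _ _
      exact hc.congr hMg
    -- sequential continuity
    refine continuous_iff_seqContinuous.2 fun f φ hf => ?_
    have hh : Tendsto (fun j => Fin.init (f j)) atTop (𝓝 (Fin.init φ)) :=
      ((continuous_pi fun i : Fin n => continuous_apply (Fin.castSucc i)).tendsto φ).comp hf
    have hg : Tendsto (fun j => f j (Fin.last n)) atTop (𝓝 (φ (Fin.last n))) :=
      ((continuous_apply (Fin.last n)).tendsto φ).comp hf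
    have key : ∀ ψ : Fin (n + 1) → 𝓢(E, V), M ψ = L (Fin.init ψ) (ψ (Fin.last n)) := fun ψ => by
      rw [hL, Fin.snoc_init_self]
    have h1 : Tendsto (fun j => L (Fin.init (f j)) (φ (Fin.last n))) atTop
        (𝓝 (L (Fin.init φ) (φ (Fin.last n)))) := by
      simp only [hL]
      exact ((hinit _).tendsto _).comp hh
    have h2 : Tendsto (fun j => L (Fin.init (f j)) (f j (Fin.last n) - φ (Fin.last n))) atTop
        (𝓝 0) := by
      have hbdd : ∀ x : 𝓢(E, V), BddAbove (Set.range fun j => ‖L (Fin.init (f j)) x‖) := by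
        intro x
        have hx : Tendsto (fun j => L (Fin.init (f j)) x) atTop (𝓝 (L (Fin.init φ) x)) := by
          simp only [hL]
          exact ((hinit x).tendsto _).comp hh
        exact hx.norm.bddAbove_range
      have hequi := ((norm_withSeminorms 𝕜 G).banach_steinhaus
        (𝓕 := fun j => L (Fin.init (f j))) fun _ x => by
          simpa only [coe_normSeminorm] using hbdd x).equicontinuous (0 : 𝓢(E, V))
      rw [Metric.equicontinuousAt_iff_right] at hequi
      rw [Metric.tendsto_nhds]
      intro ε hε
      have hd : Tendsto (fun j => f j (Fin.last n) - φ (Fin.last n)) atTop (𝓝 0) := by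
        rw [← sub_self (φ (Fin.last n))]
        exact hg.sub tendsto_const_nhds
      filter_upwards [hd.eventually (hequi ε hε)] with j hj
      have := hj j
      simp only [Function.comp_apply, map_zero] at this
      rwa [dist_comm] at this
    have h3 := h1.add h2
    rw [add_zero] at h3
    have h4 : Tendsto (M ∘ f) atTop (𝓝 (L (Fin.init φ) (φ (Fin.last n)))) := by
      refine h3.congr fun j => ?_
      rw [Function.comp_apply, key, map_sub, add_sub_cancel]
    rwa [← key] at h4

end Multilinear

end Literature.Analysis.FunctionSpaces
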